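import Summits.BirchSwinnertonDyer.Rank1Residual.X11b.Three.KodairaTransportMain
import Summits.BirchSwinnertonDyer.Rank1Residual.X11b.Three.UnramifiedMinimalDescent
import HarnessLib

/-!
# X11b at `p = 3` (team N8/O2), cross-cell service (o5o6 TARGETS (G4-6)(i)): Tate's algorithm is
# equivariant under UNRAMIFIED local homomorphisms of discrete valuation rings —
# part 4/4: the Kodaira symbol over the fraction fields, and the S15 layer

HONEST FRAMING (cell `b2b-bsdres`, run/shared/lean/b2b/bsd-rank1-residual/, verbatim in every
file): the goal of the cell is to DELETE the COMBINATION-SHAPED residual classes of the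
Birch–Swinnerton-Dyer formula for ALL analytic-rank `≤ 1` elliptic curves over `ℚ` — "full BSD
formula for every rank `≤ 1` curve in class `C`" assembled STRICTLY from published theorems — so
that the rank-`≤ 1` remainder becomes exactly the CONSTRUCTION-SHAPED classes, which are TYPED
(missing-input `Prop`s), NOT attempted. This is not "finishing BSD". Team N8/O2 = `x11b3`, seat
`b2b-bsdres-x11b3-p4` (lead GEN 7 R8-4 (b), menu (2)). THEOREMS ONLY: no definition, no named
fact, no `sorry`; nothing is booked; no mark / label / count moves.

## What

* `integralModel_map_eq_map_integralModel_of_unif` — integral models are transported along a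
  compatible pair `ψ : R₁ →+* R₂`, `φ : K₁ →+* K₂` (`φ ∘ ι₁ = ι₂ ∘ ψ`).
* **`kodairaSymbol_map_of_unif`** — for such a compatible pair with `ψ` local, `ψ π₁ = w π₂`
  (UNRAMIFIED) and perfect residue fields, and `X` over `K₁` with `Δ ≠ 0`: IF the chosen minimal
  equation of `X` stays `R₂`-minimal after `φ` (hypothesis `hmin` — the minimality half of
  Silverman *AEC* VII.5.4 (a); a THEOREM on the S15 layer by part 19, and at residue
  characteristic `≠ 2, 3` by part 16), THEN `(φX).kodairaSymbol R₂ = X.kodairaSymbol R₁`: the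
  Kodaira TYPE of `E` is unchanged in an unramified extension (Silverman *AEC* VII.5.4 (a) /
  *ATAEC* IV.9.4; part 3 + AEC VII.1.3 (b) `exists_variableChange_integralModel_eq` + the tree's
  `kodairaSymbolOfMinimal_smul`).
* **`kodairaSymbol_baseChange_eq_of_frobenius`** — the S15 layer: `X` over `F`, `L ⊇ F` with
  valuation rings `R₀ → R` and the layer data R1–R6 (`hR`, `[IsAdicComplete 𝔪 R]`, `[Finite k]` +
  `hcard`, `φ`/`hφ`/`hn`/`hfrob`, `hϖ`/`hπ`, `[IsGalois F L]`), `X` elliptic: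
  `(X ⊗ L).kodairaSymbol R = (X ⊗ F).kodairaSymbol R₀` — NO minimality hypothesis (part 19
  `isMinimal_baseChange_of_frobenius`). E/ℚ twin `kodairaSymbol_baseChange_padic_eq_of_frobenius`.

This is the Kodaira-TYPE half of the cited fact
`Literature.NumberTheory.DiophantineGeometry.kodairaSymbolAt_baseChange_of_ramificationIdx_eq_one`
(cc-typer-5, p258906; global-place currency) as a THEOREM in the layer currency; the local
Tamagawa number is NOT transported (it is not invariant: components need not stay irrational /
become rational — cc-typer-5's correction of record).

References (locators only; no new fact): [cite: SilvermanAEC2009, Prop. VII.5.4 (a) (PDF p. 175),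
VII.1 Prop. 1.3 (b)] [cite: SilvermanATAEC1994, IV.9.4 (PDF pp. 344–346), Rem. IV.9.5]
[cite: Tate1975, §§7–8].

## Design

No definitions; universe `u` for `F`, `L` in §2 (the S15 dictionary), `L : Type` in §3.
Axioms: `propext`, `Classical.choice`, `Quot.sound`.
-/

noncomputable section

open scoped Classical

open Polynomial IsLocalRing

namespace Summit.BirchSwinnertonDyer.Rank1Residual.X11b.Three.KodairaTransport

open Literature.NumberTheory.DiophantineGeometry Literature.NumberTheory.DiophantineGeometry.TateAlgorithm
  WeierstrassCurve

universe u

/-! ### §1 Over the fraction fields -/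

section Fraction

variable {R₁ K₁ R₂ K₂ : Type*}
  [CommRing R₁] [IsDomain R₁] [IsDiscreteValuationRing R₁] [Field K₁] [Algebra R₁ K₁]
  [IsFractionRing R₁ K₁]
  [CommRing R₂] [IsDomain R₂] [IsDiscreteValuationRing R₂] [Field K₂] [Algebra R₂ K₂]
  [IsFractionRing R₂ K₂]
  (ψ : R₁ →+* R₂) (φ : K₁ →+* K₂)
  (hc : ∀ r : R₁, φ (algebraMap R₁ K₁ r) = algebraMap R₂ K₂ (ψ r))

omit [IsDomain R₁] [IsDiscreteValuationRing R₁] [IsFractionRing R₁ K₁] [IsDomain R₂]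
  [IsDiscreteValuationRing R₂] in
include hc in
/-- Integral models are transported along a compatible pair `(ψ : R₁ → R₂, φ : K₁ → K₂)`: the
(unique) integral model of `φM` is `ψ` of the integral model of `M`. [folklore] -/
theorem integralModel_map_eq_map_integralModel_of_unif (M : WeierstrassCurve K₁) [IsIntegral R₁ M]
    [IsIntegral R₂ (M.map φ)] :
    integralModel R₂ (M.map φ) = (integralModel R₁ M).map ψ := by
  apply map_injective (IsFractionRing.injective R₂ K₂)
  have h₂ := baseChange_integralModel_eq R₂ (M.map φ)
  have h₁ := baseChange_integralModel_eq R₁ M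
  rw [WeierstrassCurve.baseChange] at h₂ h₁
  have hcomp : (algebraMap R₂ K₂).comp ψ = φ.comp (algebraMap R₁ K₁) := by
    ext r
    exact (hc r).symm
  change (integralModel R₂ (M.map φ)).map (algebraMap R₂ K₂) =
    ((integralModel R₁ M).map ψ).map (algebraMap R₂ K₂)
  rw [h₂, WeierstrassCurve.map_map, hcomp, ← WeierstrassCurve.map_map, h₁]

include hc in
/-- **The Kodaira symbol is unchanged in an unramified extension** (perfect residue fields):
for a compatible pair `(ψ : R₁ →+* R₂` local with `ψ π₁ = w π₂`, `φ : K₁ →+* K₂)` of DVR /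
fraction-field pairs, an `X : WeierstrassCurve K₁` with `Δ ≠ 0`, and PROVIDED the minimal
equation `X.minimal R₁` stays `R₂`-minimal after `φ` (hypothesis `hmin`: Silverman *AEC*
VII.5.4 (a), minimality half — a theorem on the S15 layer, part 19), Tate's algorithm gives the
same Kodaira symbol for `φX` over `R₂` as for `X` over `R₁`: the two minimal equations
`(φX).minimal R₂` and `φ (X.minimal R₁)` differ by an `R₂`-integral change of variables
(*AEC* VII.1.3 (b), tree `exists_variableChange_integralModel_eq`), `kodairaSymbolOfMinimal_smul`
(tree) and part 3 `kodairaSymbolOfMinimal_map_of_unif`.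
[cite: SilvermanAEC2009, Prop. VII.5.4 (a) (PDF p. 175)] [cite: SilvermanATAEC1994, IV.9.4] -/
theorem kodairaSymbol_map_of_unif [IsLocalHom ψ] [PerfectField (IsLocalRing.ResidueField R₁)]
    [PerfectField (IsLocalRing.ResidueField R₂)] {w : R₂ˣ}
    (hw : ψ (uniformizer R₁) = ↑w * uniformizer R₂) (X : WeierstrassCurve K₁) (hΔ : X.Δ ≠ 0)
    (hmin : IsMinimal R₂ ((X.minimal R₁).map φ)) :
    (X.map φ).kodairaSymbol R₂ = X.kodairaSymbol R₁ := by
  unfold kodairaSymbol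
  set C₁ := (X.exists_isMinimal R₁).choose
  set C₂ := ((X.map φ).exists_isMinimal R₂).choose
  have hM₁ : X.minimal R₁ = C₁ • X := rfl
  have hM₂ : (X.map φ).minimal R₂ = C₂ • X.map φ := rfl
  haveI hmin₁ : IsMinimal R₂ ((X.minimal R₁).map φ) := hmin
  have hrel : (X.map φ).minimal R₂ = (C₂ * (C₁.map φ)⁻¹) • (X.minimal R₁).map φ := by
    rw [hM₂, hM₁, ← map_variableChange, smul_smul, inv_mul_cancel_right]
  have hΔ' : ((X.minimal R₁).map φ).Δ ≠ 0 := by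
    rw [map_Δ, hM₁, variableChange_Δ]
    exact (map_ne_zero_iff _ φ.injective).mpr (mul_ne_zero (pow_ne_zero _ (Units.ne_zero _)) hΔ)
  obtain ⟨D', -, hD'⟩ := exists_variableChange_integralModel_eq R₂ hrel hΔ'
  rw [hD', kodairaSymbolOfMinimal_smul, integralModel_map_eq_map_integralModel_of_unif ψ φ hc,
    kodairaSymbolOfMinimal_map_of_unif ψ hw]

end Fraction

/-! ### §2 The S15 layer: no minimality hypothesis -/

section Layer

open Summit.BirchSwinnertonDyer.Rank1Residual.X11b.Three.JetchevKummer

variable {F : Type u} [Field F] (X : WeierstrassCurve F) (L : Type u) [Field L] [Algebra F L]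
  (R₀ : Type*) [CommRing R₀] [IsDomain R₀] [IsDiscreteValuationRing R₀] [Algebra R₀ F]
  [IsFractionRing R₀ F]
  (R : Type*) [CommRing R] [IsDomain R] [IsDiscreteValuationRing R] [Algebra R L]
  [IsFractionRing R L]
  [Algebra R₀ R] [Algebra R₀ L] [IsScalarTower R₀ R L] [IsScalarTower R₀ F L]
  [IsLocalHom (algebraMap R₀ R)]

/-- In the S15 dictionary the uniformiser of `R₀` maps to a unit multiple of the uniformiser of
`R` (`e = 1`, from binder R5: a uniformiser of `R` comes from `F`; part 16
`exists_irreducible_algebraMap_eq`). [folklore] -/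
theorem exists_units_algebraMap_uniformizer {ϖ : R} (hϖ : Irreducible ϖ) {π : F}
    (hπ : algebraMap F L π = algebraMap R L ϖ) :
    ∃ w : Rˣ, algebraMap R₀ R (uniformizer R₀) = ↑w * uniformizer R := by
  obtain ⟨π₀, hπ₀, hι, -⟩ := exists_irreducible_algebraMap_eq L R₀ R hϖ hπ
  obtain ⟨u, hu⟩ := IsDiscreteValuationRing.associated_of_irreducible R₀ hπ₀ irreducible_uniformizer
  refine exists_units_map_uniformizer_of_irreducible (algebraMap R₀ R) ?_
  rw [← hu, map_mul, hι]
  exact (irreducible_mul_isUnit (u.isUnit.map _)).mpr hϖ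

/-- **Silverman, *AEC* Prop. VII.5.4 (a) — the Kodaira TYPE over the S15 layer.** For `X` over
`F`, the complete Galois layer `L ⊇ F` with valuation rings `R₀ → R` (local) and the layer data
R1–R6 (`hR`, `[IsAdicComplete 𝔪 R]`, `[Finite k]` + `hcard`, `φ`/`hφ`/`hn`/`hfrob`, `hϖ`/`hπ`,
`[IsGalois F L]`), `X` elliptic and the residue field of `R₀` perfect: the Kodaira symbol of
`X ⊗ L` over `R` equals that of `X ⊗ F` over `R₀` — Tate's algorithm transported along the
unramified `R₀ → R` (parts 1–3) and the minimality of the `F`-minimal equation over `R`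
(part 19 `isMinimal_baseChange_of_frobenius`; NO minimality hypothesis). The local Tamagawa
number is NOT claimed invariant. [cite: SilvermanAEC2009, Prop. VII.5.4 (a) (PDF p. 175)]
[cite: SilvermanATAEC1994, IV.9.4] -/
theorem kodairaSymbol_baseChange_eq_of_frobenius [IsGalois F L] [X.IsElliptic]
    [IsAdicComplete (IsLocalRing.maximalIdeal R) R] [Finite (IsLocalRing.ResidueField R)]
    [PerfectField (IsLocalRing.ResidueField R₀)]
    (hR : ∀ (τ : L ≃ₐ[F] L) (x : L), x ∈ Set.range (algebraMap R L) →
      τ x ∈ Set.range (algebraMap R L))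
    (φ : L ≃ₐ[F] L) (hφ : ∀ σ : L ≃ₐ[F] L, σ ∈ Subgroup.zpowers φ) {q n : ℕ} (hn : φ ^ n = 1)
    (hcard : Nat.card (IsLocalRing.ResidueField R) = q ^ n)
    (hfrob : ∀ a : R, ∃ a' : R, algebraMap R L a' = φ (algebraMap R L a) ∧
      IsLocalRing.residue R a' = IsLocalRing.residue R a ^ q)
    {ϖ : R} (hϖ : Irreducible ϖ) {π : F} (hπ : algebraMap F L π = algebraMap R L ϖ) :
    (X.baseChange L).kodairaSymbol R = (X.baseChange F).kodairaSymbol R₀ := by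
  obtain ⟨w, hw⟩ := exists_units_algebraMap_uniformizer L R₀ R hϖ hπ
  -- minimality of the `F`-minimal equation over the layer (part 19), for the curve `C • X`
  haveI : (((X.baseChange F).minimal R₀).baseChange F).IsMinimal R₀ := by
    rw [show ((X.baseChange F).minimal R₀).baseChange F = (X.baseChange F).minimal R₀ by
      rw [WeierstrassCurve.baseChange, Algebra.algebraMap_self, WeierstrassCurve.map_id]]
    infer_instance
  haveI hmin : (((X.baseChange F).minimal R₀).baseChange L).IsMinimal R :=
    isMinimal_baseChange_of_frobenius ((X.baseChange F).minimal R₀) L R₀ R hR φ hφ hn hcard hfrob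
      hϖ hπ
  have hΔ : (X.baseChange F).Δ ≠ 0 := (X.baseChange F).isUnit_Δ.ne_zero
  have hc : ∀ r : R₀, algebraMap F L (algebraMap R₀ F r) = algebraMap R L (algebraMap R₀ R r) :=
    fun r ↦ by rw [← IsScalarTower.algebraMap_apply, ← IsScalarTower.algebraMap_apply]
  have key := kodairaSymbol_map_of_unif (algebraMap R₀ R) (algebraMap F L) hc hw (X.baseChange F)
    hΔ hmin
  have hX : (X.baseChange F).map (algebraMap F L) = X.baseChange L := by
    rw [WeierstrassCurve.baseChange, WeierstrassCurve.baseChange, WeierstrassCurve.map_map,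
      Algebra.algebraMap_self, RingHom.comp_id]
  rwa [hX] at key

end Layer

/-! ### §3 `E/ℚ` at any prime `p` -/

section Padic

open Summit.BirchSwinnertonDyer.Rank1Residual.X11b.Three.JetchevKummer

variable (W : WeierstrassCurve ℚ) [W.IsElliptic] (p : ℕ) [Fact p.Prime]
  (L : Type) [Field L] [Algebra ℚ_[p] L]
  (R : Type*) [CommRing R] [IsDomain R] [IsDiscreteValuationRing R] [Algebra R L]
  [IsFractionRing R L] [Algebra ℤ_[p] R] [Algebra ℤ_[p] L] [IsScalarTower ℤ_[p] R L]
  [IsScalarTower ℤ_[p] ℚ_[p] L] [IsLocalHom (algebraMap ℤ_[p] R)]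

/-- **The Kodaira type of `E/ℚ` at `p` is unchanged over every complete unramified Galois layer
`L ⊇ ℚ_p`** (layer data R1–R6; any prime `p`, any reduction type; no minimality
hypothesis on `W`): `((W ⊗ ℚ_p) ⊗ L).kodairaSymbol R = (W ⊗ ℚ_p).kodairaSymbol ℤ_p`. [cite: SilvermanAEC2009, Prop. VII.5.4 (a) (PDF p. 175)]
[cite: SilvermanATAEC1994, IV.9.4] -/
theorem kodairaSymbol_baseChange_padic_eq_of_frobenius [IsGalois ℚ_[p] L]
    [IsAdicComplete (IsLocalRing.maximalIdeal R) R] [Finite (IsLocalRing.ResidueField R)]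
    (hR : ∀ (τ : L ≃ₐ[ℚ_[p]] L) (x : L), x ∈ Set.range (algebraMap R L) →
      τ x ∈ Set.range (algebraMap R L))
    (φ : L ≃ₐ[ℚ_[p]] L) (hφ : ∀ σ : L ≃ₐ[ℚ_[p]] L, σ ∈ Subgroup.zpowers φ) {q n : ℕ}
    (hn : φ ^ n = 1) (hcard : Nat.card (IsLocalRing.ResidueField R) = q ^ n)
    (hfrob : ∀ a : R, ∃ a' : R, algebraMap R L a' = φ (algebraMap R L a) ∧
      IsLocalRing.residue R a' = IsLocalRing.residue R a ^ q)
    {ϖ : R} (hϖ : Irreducible ϖ) {π : ℚ_[p]} (hπ : algebraMap ℚ_[p] L π = algebraMap R L ϖ) :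
    ((W.baseChange ℚ_[p]).baseChange L).kodairaSymbol R = (W.baseChange ℚ_[p]).kodairaSymbol ℤ_[p] := by
  have h := kodairaSymbol_baseChange_eq_of_frobenius (W.baseChange ℚ_[p]) L ℤ_[p] R hR φ hφ hn hcard
    hfrob hϖ hπ
  rwa [baseChange_padic_baseChange_self] at h

end Padic

end Summit.BirchSwinnertonDyer.Rank1Residual.X11b.Three.KodairaTransport

end
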